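import Summits.QuantumFields.BalabanUV.Beta.GAN24.DressedKernelOnCurrent
import Summits.QuantumFields.BalabanUV.Beta.GAN24.DressedWilsonHalfVertex
import Summits.QuantumFields.BalabanUV.Beta.GAN24.FaceCurrentExchangeValue

/-!
# (C)sym at level 0 — the dressed step kernel applied to the background-resummed right half-vertex, and the cell value of the EE word
# (blueprint links (E2)∘(E3), and (E4)′∘(E5) over one cell)

WHAT. The right half of the level-0 EE exchange word, with its background bond `(ν, u′)` and its exit-face leg `w` resummed, is the explicit
block-periodic divergence-free CURRENT `t_R(b, z) = K₁·(+½·curvAdj F_{νβ} b z)` (`DressedWilsonHalfVertex.hasSum_faceHalfVertex_snd`;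
`F_{νβ} = 𝟙f ⊗ 𝟙f` on the `(ν, β)`-plaquettes, `𝟙f(n) = [n % Lc = Lc − 1]`, `K₁ = (Lc·s_m s_f·σ_0)·((s_f s_m)⁻¹ s_f⁻² cE)`), and the level-0 dressed step
kernel `X̃♮_0 = unitK s_f s_m (Πkᵀ ∘ KInvStep Lc 0 ∘ Πk)` acts on such currents by `DressedKernelOnCurrent` §3.  This file discharges the three
admissibility hypotheses for every scalar multiple `c·curvAdj F` of the co-derivative of a block-periodic 2-form and records the composite:

* §1 `smul_curvAdj_periodic` (block-periodic: `PeriodicKKTResponseFlux.current_periodic`), `smul_curvAdj_divFree` (divergence-free at every site: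
  an4∕an5's `ResolventComposition.codiff₁_curvAdj`, `δ ∘ d* = 0`), `sum_box_smul_curvAdj` (zero cell totals: `PeriodicKKTResponseFlux.sum_box_curvAdj_eq_zero`),
  `facePlaq_periodic` (the exit-face plaquette form is block-periodic);
* §2 **`tsum_dressedStep_zero_inl_mul_halfVertex_snd`**: `Σ'_z Σ_b X̃♮_0 y z (inl a)(inl b)·(Σ'_{u′} Σ'_w 𝟙f(w_β)·vertexOfK X̃♮_0 Lc S^E ν u′ z w (inl b)(inl β))
  = s_f²·Π_bm(Γ_{Lc}·t_R)(a, y)` (field rows), **`tsum_dressedStep_zero_inr_mul_halfVertex_snd`**: the multiplier rows VANISH (fact (d1) «Φ = 0»);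
* §3 `respA_smul` (the `Γ_{Lc}`-response is linear in the scalar), `tsum_faceHalfVertex_fst` (the resummed LEFT family at a point is `K₁·(−½·curvAdj F_{μα})`);
* §4 **`sum_box_leftFamily_mul_dressed_halfVertex_snd`** — THE CELL VALUE OF THE EE WORD: `Σ_{r′ ∈ box} Σ_a (K₁·(−½·curvAdj F_{μα} a r′))·(s_f²·Π_bm(Γ_{Lc}·t_R)(a, r′))
  = −K₁²·s_f²·E·½·(1 − Lc⁻²)·Lc^{d−1}`, `E = [μ=ν][α=β] − [μ=β][α=ν]` (cell adjointness `DressedKernelOnCurrent.sum_box_mul_coProjBmW`, `Πᵀ_bm J = J` by leaf-02's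
  `CoProjBmDivFree`, and `FaceCurrentExchangeValue.pairing_face`).  The EE word with its first bond over `box Lc` is `|box| = Lc^{d+1}` times this number
  (`CoarseBondCellPairing`; blueprint §5 as corrected by C-leaf04-g65-1) — that last step (covariance + summability of the left family) is NOT done here.

HONEST: [folklore] BY NAME over files `DressedKernelOnCurrent` ∕ `DressedWilsonHalfVertex` ∕ `PeriodicKKTResponseFlux` of this lineage and `codiff₁_curvAdj`;
no value of Bałaban's tables beyond an3's DEFINED stencil is asserted; (C)sym stays DISPLAYED — nothing of (C)∕(Q-D)∕(Q-D-rate) is discharged; NEVER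
«G-an2-4 closed» as (CONV-C); NOT D1, NOT BetaPertH, NOT continuum, NOT Clay.
-/

noncomputable section

open Finset
open scoped BigOperators
open Literature.MathematicalPhysics.QuantumFieldTheory
open Literature.MathematicalPhysics.QuantumFieldTheory.Balaban1983to89
open Literature.MathematicalPhysics.QuantumFieldTheory.Balaban1983to89.Beta
open ExpKernelCalculus (Site MKer)
open OneStepResolventKernel (Fib)
open OneStepKernelFamily (KInvStep vertexOfK)
open StepJetData (wilsonA)
open AffineAveraging (Form1 Form2 box toSite curvAdj unitVec codiff₁)
open KKTFluctuationKernel (Gam)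
open PeriodicDescent (IsPeriodic)
open Summit.QuantumFields.BalabanUV.Beta.AxialDressingRooted (coDressKBmAt coProjBmW)
open Summit.QuantumFields.BalabanUV.Beta.HessKerDressedUnits (unitK unitS)
open Summit.QuantumFields.BalabanUV.Beta.GAN24.PeriodicKKTResponseFlux (current_periodic sum_box_curvAdj_eq_zero)
open Summit.QuantumFields.BalabanUV.Beta.GAN24.DressedKernelOnCurrent (tsum_dressedStep_zero_inl_mul_current tsum_dressedStep_zero_inr_mul_current)
open Summit.QuantumFields.BalabanUV.Beta.GAN24.DressedWilsonHalfVertex (hasSum_faceHalfVertex_snd hasSum_faceHalfVertex_fst)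
open Summit.QuantumFields.BalabanUV.Beta.GAN24.CoProjBmDivFree (coProjBmAt_eq_self_of_divFree)

namespace Summit.QuantumFields.BalabanUV.Beta.GAN24.DressedKernelOnFaceCurrent

variable {d : ℕ}

/-! ## §1 Scalar multiples of the co-derivative of a block-periodic 2-form are admissible currents -/

section Admissible

variable {N : ℕ}

/-- [folklore] `c·curvAdj F` is block-periodic when `F` is (`PeriodicKKTResponseFlux.current_periodic`). -/
theorem smul_curvAdj_periodic {F : Form2 (d + 1) ℝ} (hF : ∀ κ l, IsPeriodic N (F κ l)) (c : ℝ) (l : Fin (d + 1))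
    (y s : AffineAveraging.Site (d + 1)) : c * curvAdj F l (y + (N : ℤ) • s) = c * curvAdj F l y := by
  have h := current_periodic (N := N) hF l y s
  have h2 : curvAdj F l (y + (N : ℤ) • s) = curvAdj F l y := mul_left_cancel₀ (by norm_num : (-(1 / 2 : ℝ)) ≠ 0) h
  rw [h2]

/-- [folklore] `c·curvAdj F` is DIVERGENCE-FREE at every site, for EVERY 2-form `F` (`δ ∘ d* = 0`, `ResolventComposition.codiff₁_curvAdj`), in the hypothesis shape
of leaf-02's `CoProjBmDivFree.coProjBmAt_eq_self_of_divFree` and of `DressedKernelOnCurrent` §3. -/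
theorem smul_curvAdj_divFree (F : Form2 (d + 1) ℝ) (c : ℝ) (p : AffineAveraging.Site (d + 1)) :
    ∑ β : Fin (d + 1), (c * curvAdj F β p - c * curvAdj F β (p - unitVec β)) = 0 := by
  have h := congrFun (ResolventComposition.codiff₁_curvAdj F) p
  simp only [codiff₁, Pi.zero_apply] at h
  have e : ∑ β : Fin (d + 1), (c * curvAdj F β p - c * curvAdj F β (p - unitVec β)) =
      -c * ∑ β : Fin (d + 1), (curvAdj F β (p - unitVec β) - curvAdj F β p) := by
    rw [Finset.mul_sum]
    exact Finset.sum_congr rfl fun β _ => by ring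
  rw [e, h, mul_zero]

/-- [folklore] `c·curvAdj F` has ZERO CELL TOTALS when `F` is block-periodic (`PeriodicKKTResponseFlux.sum_box_curvAdj_eq_zero`). -/
theorem sum_box_smul_curvAdj [NeZero N] {F : Form2 (d + 1) ℝ} (hF : ∀ κ l, IsPeriodic N (F κ l)) (c : ℝ) (l : Fin (d + 1)) :
    ∑ r ∈ box (d + 1) N, c * curvAdj F l (toSite r) = 0 := by
  rw [← Finset.mul_sum, sum_box_curvAdj_eq_zero (N := N) hF, mul_zero]

/-- [folklore] The EXIT-FACE PLAQUETTE FORM `F_{να}(κ,l,x) = [κ=ν][l=α]·𝟙f(x_ν)𝟙f(x_α) − [κ=α][l=ν]·𝟙f(x_ν)𝟙f(x_α)` is block-periodic. -/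
theorem facePlaq_periodic (N : ℕ) (ν α κ l : Fin (d + 1)) :
    IsPeriodic N (fun x : AffineAveraging.Site (d + 1) =>
      (if κ = ν ∧ l = α then (if x ν % (N : ℤ) = (N : ℤ) - 1 then (1 : ℝ) else 0) * (if x α % (N : ℤ) = (N : ℤ) - 1 then (1 : ℝ) else 0) else 0) -
      (if κ = α ∧ l = ν then (if x ν % (N : ℤ) = (N : ℤ) - 1 then (1 : ℝ) else 0) * (if x α % (N : ℤ) = (N : ℤ) - 1 then (1 : ℝ) else 0) else 0)) := by
  intro x a
  simp only [Pi.add_apply, Pi.smul_apply, smul_eq_mul, Int.add_mul_emod_self_left]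

end Admissible

/-! ## §2 The dressed step kernel at level 0 applied to the resummed right half-vertex -/

section Composite

variable {Lc : ℕ} [NeZero Lc] {r : Fin (d + 1) → ℕ} {ν β : Fin (d + 1)} (hνβ : ν ≠ β)
include hνβ

/-- [folklore] **FIELD ROWS**: `X̃♮_0` applied to the background-resummed, exit-face-weighted right half-vertex is `s_f²·Π_bm` of the `Γ_{Lc}`-response to the
current `t_R = K₁·(+½·curvAdj F_{νβ})` (in-block root, `1 ≤ Lc`, all units, `ν ≠ β`; `DressedWilsonHalfVertex.hasSum_faceHalfVertex_snd` ⨾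
`DressedKernelOnCurrent.tsum_dressedStep_zero_inl_mul_current` with §1). -/
theorem tsum_dressedStep_zero_inl_mul_halfVertex_snd (hLc : 1 ≤ Lc) (hr : r ∈ box (d + 1) Lc) (sf sm cE : ℝ) (y : Site (d + 1)) (a : Fin (d + 1)) :
    ∑' z : Site (d + 1), ∑ b : Fin (d + 1), unitK sf sm (coDressKBmAt (toSite r) Lc (KInvStep (d := d) Lc 0)) y z (Sum.inl a) (Sum.inl b) *
        (∑' u' : Site (d + 1), ∑' w : Site (d + 1), (if w β % (Lc : ℤ) = (Lc : ℤ) - 1 then (1 : ℝ) else 0) *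
          vertexOfK (unitK sf sm (coDressKBmAt (toSite r) Lc (KInvStep (d := d) Lc 0))) Lc (unitS sf sm (fun κ v => cE • wilsonA d κ v)) ν u' z w
            (Sum.inl b) (Sum.inl β)) =
      (sf * sf) * coProjBmW (toSite r) Lc (fun κ u => ∑' u'' : Site (d + 1), ∑ κ' : Fin (d + 1),
        ((((Lc : ℝ) * (sm * sf)) * ((((Lc ^ (0 + 1) : ℕ) : ℝ)) ^ (d + 1 + 1))⁻¹) * ((sf * sm)⁻¹ * (sf⁻¹ * sf⁻¹) * cE) *
          ((1 / 2 : ℝ) * curvAdj (fun κ l (x : Site (d + 1)) =>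
            (if κ = ν ∧ l = β then (if x ν % (Lc : ℤ) = (Lc : ℤ) - 1 then (1 : ℝ) else 0) * (if x β % (Lc : ℤ) = (Lc : ℤ) - 1 then (1 : ℝ) else 0) else 0) -
            (if κ = β ∧ l = ν then (if x ν % (Lc : ℤ) = (Lc : ℤ) - 1 then (1 : ℝ) else 0) * (if x β % (Lc : ℤ) = (Lc : ℤ) - 1 then (1 : ℝ) else 0) else 0)) κ' u'')) *
          Gam (N := Lc) κ u κ' u'') a y := by
  have e : ∀ (z : Site (d + 1)) (b : Fin (d + 1)),
      (∑' u' : Site (d + 1), ∑' w : Site (d + 1), (if w β % (Lc : ℤ) = (Lc : ℤ) - 1 then (1 : ℝ) else 0) *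
          vertexOfK (unitK sf sm (coDressKBmAt (toSite r) Lc (KInvStep (d := d) Lc 0))) Lc (unitS sf sm (fun κ v => cE • wilsonA d κ v)) ν u' z w
            (Sum.inl b) (Sum.inl β)) =
        (((Lc : ℝ) * (sm * sf)) * ((((Lc ^ (0 + 1) : ℕ) : ℝ)) ^ (d + 1 + 1))⁻¹) * ((sf * sm)⁻¹ * (sf⁻¹ * sf⁻¹) * cE) *
          ((1 / 2 : ℝ) * curvAdj (fun κ l (x : Site (d + 1)) =>
            (if κ = ν ∧ l = β then (if x ν % (Lc : ℤ) = (Lc : ℤ) - 1 then (1 : ℝ) else 0) * (if x β % (Lc : ℤ) = (Lc : ℤ) - 1 then (1 : ℝ) else 0) else 0) -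
            (if κ = β ∧ l = ν then (if x ν % (Lc : ℤ) = (Lc : ℤ) - 1 then (1 : ℝ) else 0) * (if x β % (Lc : ℤ) = (Lc : ℤ) - 1 then (1 : ℝ) else 0) else 0)) b z) :=
    fun z b => (hasSum_faceHalfVertex_snd hνβ hLc hr sf sm cE 0 b z).tsum_eq
  simp only [e]
  have hF := facePlaq_periodic (d := d) Lc ν β
  have e2 : ∀ (b : Fin (d + 1)) (z : Site (d + 1)),
      (((Lc : ℝ) * (sm * sf)) * ((((Lc ^ (0 + 1) : ℕ) : ℝ)) ^ (d + 1 + 1))⁻¹) * ((sf * sm)⁻¹ * (sf⁻¹ * sf⁻¹) * cE) *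
          ((1 / 2 : ℝ) * curvAdj (fun κ l (x : Site (d + 1)) =>
            (if κ = ν ∧ l = β then (if x ν % (Lc : ℤ) = (Lc : ℤ) - 1 then (1 : ℝ) else 0) * (if x β % (Lc : ℤ) = (Lc : ℤ) - 1 then (1 : ℝ) else 0) else 0) -
            (if κ = β ∧ l = ν then (if x ν % (Lc : ℤ) = (Lc : ℤ) - 1 then (1 : ℝ) else 0) * (if x β % (Lc : ℤ) = (Lc : ℤ) - 1 then (1 : ℝ) else 0) else 0)) b z) =
        ((((Lc : ℝ) * (sm * sf)) * ((((Lc ^ (0 + 1) : ℕ) : ℝ)) ^ (d + 1 + 1))⁻¹) * ((sf * sm)⁻¹ * (sf⁻¹ * sf⁻¹) * cE) * (1 / 2 : ℝ)) *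
          curvAdj (fun κ l (x : Site (d + 1)) =>
            (if κ = ν ∧ l = β then (if x ν % (Lc : ℤ) = (Lc : ℤ) - 1 then (1 : ℝ) else 0) * (if x β % (Lc : ℤ) = (Lc : ℤ) - 1 then (1 : ℝ) else 0) else 0) -
            (if κ = β ∧ l = ν then (if x ν % (Lc : ℤ) = (Lc : ℤ) - 1 then (1 : ℝ) else 0) * (if x β % (Lc : ℤ) = (Lc : ℤ) - 1 then (1 : ℝ) else 0) else 0)) b z :=
    fun b z => by ring
  simp only [e2]
  exact tsum_dressedStep_zero_inl_mul_current hLc hr sf sm (fun l y' s => smul_curvAdj_periodic (N := Lc) hF _ l y' s)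
    (fun p => smul_curvAdj_divFree _ _ p) y a

/-- [folklore] **MULTIPLIER ROWS VANISH**: the `(inr m, inl ·)` rows of `X̃♮_0` kill the resummed right half-vertex — the current `t_R` has zero cell totals
(fact (d1) «Φ = 0» of note g64 §3 at its place in the exchange word; `DressedKernelOnCurrent.tsum_dressedStep_zero_inr_mul_current` with §1). -/
theorem tsum_dressedStep_zero_inr_mul_halfVertex_snd (hLc : 1 ≤ Lc) (hr : r ∈ box (d + 1) Lc) (sf sm cE : ℝ) (y : Site (d + 1)) (m : Fin (d + 1)) :
    ∑' z : Site (d + 1), ∑ b : Fin (d + 1), unitK sf sm (coDressKBmAt (toSite r) Lc (KInvStep (d := d) Lc 0)) y z (Sum.inr m) (Sum.inl b) *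
        (∑' u' : Site (d + 1), ∑' w : Site (d + 1), (if w β % (Lc : ℤ) = (Lc : ℤ) - 1 then (1 : ℝ) else 0) *
          vertexOfK (unitK sf sm (coDressKBmAt (toSite r) Lc (KInvStep (d := d) Lc 0))) Lc (unitS sf sm (fun κ v => cE • wilsonA d κ v)) ν u' z w
            (Sum.inl b) (Sum.inl β)) = 0 := by
  have e : ∀ (z : Site (d + 1)) (b : Fin (d + 1)),
      (∑' u' : Site (d + 1), ∑' w : Site (d + 1), (if w β % (Lc : ℤ) = (Lc : ℤ) - 1 then (1 : ℝ) else 0) *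
          vertexOfK (unitK sf sm (coDressKBmAt (toSite r) Lc (KInvStep (d := d) Lc 0))) Lc (unitS sf sm (fun κ v => cE • wilsonA d κ v)) ν u' z w
            (Sum.inl b) (Sum.inl β)) =
        (((Lc : ℝ) * (sm * sf)) * ((((Lc ^ (0 + 1) : ℕ) : ℝ)) ^ (d + 1 + 1))⁻¹) * ((sf * sm)⁻¹ * (sf⁻¹ * sf⁻¹) * cE) *
          ((1 / 2 : ℝ) * curvAdj (fun κ l (x : Site (d + 1)) =>
            (if κ = ν ∧ l = β then (if x ν % (Lc : ℤ) = (Lc : ℤ) - 1 then (1 : ℝ) else 0) * (if x β % (Lc : ℤ) = (Lc : ℤ) - 1 then (1 : ℝ) else 0) else 0) -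
            (if κ = β ∧ l = ν then (if x ν % (Lc : ℤ) = (Lc : ℤ) - 1 then (1 : ℝ) else 0) * (if x β % (Lc : ℤ) = (Lc : ℤ) - 1 then (1 : ℝ) else 0) else 0)) b z) :=
    fun z b => (hasSum_faceHalfVertex_snd hνβ hLc hr sf sm cE 0 b z).tsum_eq
  simp only [e]
  have hF := facePlaq_periodic (d := d) Lc ν β
  have e2 : ∀ (b : Fin (d + 1)) (z : Site (d + 1)),
      (((Lc : ℝ) * (sm * sf)) * ((((Lc ^ (0 + 1) : ℕ) : ℝ)) ^ (d + 1 + 1))⁻¹) * ((sf * sm)⁻¹ * (sf⁻¹ * sf⁻¹) * cE) *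
          ((1 / 2 : ℝ) * curvAdj (fun κ l (x : Site (d + 1)) =>
            (if κ = ν ∧ l = β then (if x ν % (Lc : ℤ) = (Lc : ℤ) - 1 then (1 : ℝ) else 0) * (if x β % (Lc : ℤ) = (Lc : ℤ) - 1 then (1 : ℝ) else 0) else 0) -
            (if κ = β ∧ l = ν then (if x ν % (Lc : ℤ) = (Lc : ℤ) - 1 then (1 : ℝ) else 0) * (if x β % (Lc : ℤ) = (Lc : ℤ) - 1 then (1 : ℝ) else 0) else 0)) b z) =
        ((((Lc : ℝ) * (sm * sf)) * ((((Lc ^ (0 + 1) : ℕ) : ℝ)) ^ (d + 1 + 1))⁻¹) * ((sf * sm)⁻¹ * (sf⁻¹ * sf⁻¹) * cE) * (1 / 2 : ℝ)) *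
          curvAdj (fun κ l (x : Site (d + 1)) =>
            (if κ = ν ∧ l = β then (if x ν % (Lc : ℤ) = (Lc : ℤ) - 1 then (1 : ℝ) else 0) * (if x β % (Lc : ℤ) = (Lc : ℤ) - 1 then (1 : ℝ) else 0) else 0) -
            (if κ = β ∧ l = ν then (if x ν % (Lc : ℤ) = (Lc : ℤ) - 1 then (1 : ℝ) else 0) * (if x β % (Lc : ℤ) = (Lc : ℤ) - 1 then (1 : ℝ) else 0) else 0)) b z :=
    fun b z => by ring
  simp only [e2]
  exact tsum_dressedStep_zero_inr_mul_current hLc hr sf sm (fun l y' s => smul_curvAdj_periodic (N := Lc) hF _ l y' s)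
    (fun p => smul_curvAdj_divFree _ _ p) (fun l => sum_box_smul_curvAdj (N := Lc) hF _ l) y m

end Composite

/-! ## §3 Linearity of the response in the scalar; the resummed left family at a point -/

/-- [folklore] The `Γ_N`-response is linear in a scalar factor of the current: `Σ'_{u″} Σ_{κ′} (c·t κ′ u″)·Γ κ u κ′ u″ = c·Σ'_{u″} Σ_{κ′} t κ′ u″·Γ κ u κ′ u″`. -/
theorem respA_smul {N : ℕ} [NeZero N] (c : ℝ) (t : Form1 (d + 1) ℝ) (κ : Fin (d + 1)) (u : Site (d + 1)) :
    ∑' u'' : Site (d + 1), ∑ κ' : Fin (d + 1), (c * t κ' u'') * Gam (N := N) κ u κ' u'' =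
      c * ∑' u'' : Site (d + 1), ∑ κ' : Fin (d + 1), t κ' u'' * Gam (N := N) κ u κ' u'' := by
  rw [← tsum_mul_left]
  refine tsum_congr fun u'' => ?_
  rw [Finset.mul_sum]
  exact Finset.sum_congr rfl fun κ' _ => by ring

section LeftFamily

variable {Lc : ℕ} [NeZero Lc] {r : Fin (d + 1) → ℕ} {μ α : Fin (d + 1)} (hμα : μ ≠ α)
include hμα

/-- [folklore] **THE RESUMMED LEFT FAMILY AT A POINT** (`tsum` form of `DressedWilsonHalfVertex.hasSum_faceHalfVertex_fst`, any level `j`):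
`Σ'_u Σ'_y 𝟙f(y_α)·vertexOfK X̃♮_j Lc S^E μ u y z (inl α)(inl a) = K₁·(−½·curvAdj F_{μα} a z)`. -/
theorem tsum_faceHalfVertex_fst (hLc : 1 ≤ Lc) (hr : r ∈ box (d + 1) Lc) (sf sm cE : ℝ) (j : ℕ) (a : Fin (d + 1)) (z : Site (d + 1)) :
    ∑' u : Site (d + 1), ∑' y : Site (d + 1), (if y α % (Lc : ℤ) = (Lc : ℤ) - 1 then (1 : ℝ) else 0) *
        vertexOfK (unitK sf sm (coDressKBmAt (toSite r) Lc (KInvStep (d := d) Lc j))) Lc (unitS sf sm (fun κ v => cE • wilsonA d κ v)) μ u y z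
          (Sum.inl α) (Sum.inl a) =
      (((Lc : ℝ) * (sm * sf)) * ((((Lc ^ (j + 1) : ℕ) : ℝ)) ^ (d + 1 + 1))⁻¹) * ((sf * sm)⁻¹ * (sf⁻¹ * sf⁻¹) * cE) *
        (-(1 / 2 : ℝ) * curvAdj (fun κ l (x : Site (d + 1)) =>
          (if κ = μ ∧ l = α then (if x μ % (Lc : ℤ) = (Lc : ℤ) - 1 then (1 : ℝ) else 0) * (if x α % (Lc : ℤ) = (Lc : ℤ) - 1 then (1 : ℝ) else 0) else 0) -
          (if κ = α ∧ l = μ then (if x μ % (Lc : ℤ) = (Lc : ℤ) - 1 then (1 : ℝ) else 0) * (if x α % (Lc : ℤ) = (Lc : ℤ) - 1 then (1 : ℝ) else 0) else 0)) a z) :=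
  (hasSum_faceHalfVertex_fst hμα hLc hr sf sm cE j a z).tsum_eq

end LeftFamily


/-! ## §4 The cell value of the EE word (everything but the first-slot cell sum) -/

section CellValue

variable {Lc : ℕ} [NeZero Lc] {r : Fin (d + 1) → ℕ} {μ ν α β : Fin (d + 1)}

/-- [folklore] **THE CELL VALUE OF THE LEVEL-0 EE WORD** (in-block root, `1 ≤ Lc`, all units, `ν ≠ β`; any `(μ, α)` — for `μ = α` both sides vanish): pairing, over one cell, the resummed LEFT
family `K₁·(−½·curvAdj F_{μα})` (§3) with the field rows of `X̃♮_0` on the resummed RIGHT half-vertex `s_f²·Π_bm(Γ_{Lc}·t_R)` (§2) gives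
`Σ_{r′ ∈ box} Σ_a (K₁·(−½·curvAdj F_{μα} a r′))·(s_f²·Π_bm(Γ_{Lc}·t_R)(a, r′)) = −K₁²·s_f²·E·½·(1 − Lc⁻²)·Lc^{d−1}`,
`E = [μ=ν][α=β] − [μ=β][α=ν]` — cell adjointness `⟨J, Π_bm A⟩_cell = ⟨Πᵀ_bm J, A⟩_cell` (`DressedKernelOnCurrent.sum_box_mul_coProjBmW`), `Πᵀ_bm J = J`
(leaf-02 `CoProjBmDivFree.coProjBmAt_eq_self_of_divFree`, §1), linearity (§3 `respA_smul`) and `FaceCurrentExchangeValue.pairing_face`.  By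
`CoarseBondCellPairing.sum_box_tsum_sum_mul_periodic_of_cov` the EE word with its first bond over `box Lc` is `|box| = Lc^{d+1}` times this number
(blueprint §5 as corrected by C-leaf04-g65-1); that last composition (covariance + summability of the left family) is NOT done here. -/
theorem sum_box_leftFamily_mul_dressed_halfVertex_snd (hνβ : ν ≠ β) (hLc : 1 ≤ Lc) (hr : r ∈ box (d + 1) Lc) (sf sm cE : ℝ) :
    ∑ r' ∈ box (d + 1) Lc, ∑ a : Fin (d + 1),
        ((((Lc : ℝ) * (sm * sf)) * ((((Lc ^ (0 + 1) : ℕ) : ℝ)) ^ (d + 1 + 1))⁻¹) * ((sf * sm)⁻¹ * (sf⁻¹ * sf⁻¹) * cE) *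
          (-(1 / 2 : ℝ) * curvAdj (fun κ l (x : Site (d + 1)) =>
            (if κ = μ ∧ l = α then (if x μ % (Lc : ℤ) = (Lc : ℤ) - 1 then (1 : ℝ) else 0) * (if x α % (Lc : ℤ) = (Lc : ℤ) - 1 then (1 : ℝ) else 0) else 0) -
            (if κ = α ∧ l = μ then (if x μ % (Lc : ℤ) = (Lc : ℤ) - 1 then (1 : ℝ) else 0) * (if x α % (Lc : ℤ) = (Lc : ℤ) - 1 then (1 : ℝ) else 0) else 0)) a (toSite r'))) *
        ((sf * sf) * coProjBmW (toSite r) Lc (fun κ u => ∑' u'' : Site (d + 1), ∑ κ' : Fin (d + 1),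
          ((((Lc : ℝ) * (sm * sf)) * ((((Lc ^ (0 + 1) : ℕ) : ℝ)) ^ (d + 1 + 1))⁻¹) * ((sf * sm)⁻¹ * (sf⁻¹ * sf⁻¹) * cE) *
            ((1 / 2 : ℝ) * curvAdj (fun κ l (x : Site (d + 1)) =>
              (if κ = ν ∧ l = β then (if x ν % (Lc : ℤ) = (Lc : ℤ) - 1 then (1 : ℝ) else 0) * (if x β % (Lc : ℤ) = (Lc : ℤ) - 1 then (1 : ℝ) else 0) else 0) -
              (if κ = β ∧ l = ν then (if x ν % (Lc : ℤ) = (Lc : ℤ) - 1 then (1 : ℝ) else 0) * (if x β % (Lc : ℤ) = (Lc : ℤ) - 1 then (1 : ℝ) else 0) else 0)) κ' u'')) *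
            Gam (N := Lc) κ u κ' u'') a (toSite r')) =
      -((((Lc : ℝ) * (sm * sf)) * ((((Lc ^ (0 + 1) : ℕ) : ℝ)) ^ (d + 1 + 1))⁻¹) * ((sf * sm)⁻¹ * (sf⁻¹ * sf⁻¹) * cE)) ^ 2 * (sf * sf) *
        (((if μ = ν ∧ α = β then (1 : ℝ) else 0) - (if μ = β ∧ α = ν then (1 : ℝ) else 0)) * ((1 / 2 : ℝ) * (1 - ((Lc : ℝ) ^ 2)⁻¹) * (Lc : ℝ) ^ (d - 1))) := by
  -- names for the two face forms, the constant and the two currents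
  set Fμα : Form2 (d + 1) ℝ := fun κ l (x : Site (d + 1)) =>
    (if κ = μ ∧ l = α then (if x μ % (Lc : ℤ) = (Lc : ℤ) - 1 then (1 : ℝ) else 0) * (if x α % (Lc : ℤ) = (Lc : ℤ) - 1 then (1 : ℝ) else 0) else 0) -
    (if κ = α ∧ l = μ then (if x μ % (Lc : ℤ) = (Lc : ℤ) - 1 then (1 : ℝ) else 0) * (if x α % (Lc : ℤ) = (Lc : ℤ) - 1 then (1 : ℝ) else 0) else 0) with hFμα
  set Fνβ : Form2 (d + 1) ℝ := fun κ l (x : Site (d + 1)) =>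
    (if κ = ν ∧ l = β then (if x ν % (Lc : ℤ) = (Lc : ℤ) - 1 then (1 : ℝ) else 0) * (if x β % (Lc : ℤ) = (Lc : ℤ) - 1 then (1 : ℝ) else 0) else 0) -
    (if κ = β ∧ l = ν then (if x ν % (Lc : ℤ) = (Lc : ℤ) - 1 then (1 : ℝ) else 0) * (if x β % (Lc : ℤ) = (Lc : ℤ) - 1 then (1 : ℝ) else 0) else 0) with hFνβ
  set K₁ : ℝ := (((Lc : ℝ) * (sm * sf)) * ((((Lc ^ (0 + 1) : ℕ) : ℝ)) ^ (d + 1 + 1))⁻¹) * ((sf * sm)⁻¹ * (sf⁻¹ * sf⁻¹) * cE) with hK₁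
  have hFp : ∀ κ l, IsPeriodic Lc (Fμα κ l) := facePlaq_periodic (d := d) Lc μ α
  have hGp : ∀ κ l, IsPeriodic Lc (Fνβ κ l) := facePlaq_periodic (d := d) Lc ν β
  -- the response `A = Γ·t_R` and the bare response `R = Γ·J_F`
  set A : Form1 (d + 1) ℝ := fun κ u => ∑' u'' : Site (d + 1), ∑ κ' : Fin (d + 1), (K₁ * ((1 / 2 : ℝ) * curvAdj Fνβ κ' u'')) * Gam (N := Lc) κ u κ' u'' with hA
  set R : Form1 (d + 1) ℝ := fun κ u => ∑' u'' : Site (d + 1), ∑ κ' : Fin (d + 1), (-(1 / 2 : ℝ) * curvAdj Fνβ κ' u'') * Gam (N := Lc) κ u κ' u'' with hR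
  have hAR : ∀ κ u, A κ u = (K₁ * (-1 : ℝ)) * R κ u := by
    intro κ u
    simp only [hA, hR]
    rw [← respA_smul (N := Lc) (K₁ * (-1 : ℝ)) (fun κ' u'' => -(1 / 2 : ℝ) * curvAdj Fνβ κ' u'') κ u]
    refine tsum_congr fun u'' => Finset.sum_congr rfl fun κ' _ => ?_
    ring
  have hAp : ∀ a, IsPeriodic Lc (A a) := by
    intro a x t
    simp only [hA]
    exact PeriodicKKTResponse.respA_periodic (N := Lc) (fun l y s => by
      have h := smul_curvAdj_periodic (N := Lc) hGp (1 / 2 : ℝ) l y s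
      rw [h]) a x t
  set J : Form1 (d + 1) ℝ := fun a y => K₁ * (-(1 / 2 : ℝ) * curvAdj Fμα a y) with hJ
  have hJp : ∀ a, IsPeriodic Lc (J a) := by
    intro a x t
    simp only [hJ]
    rw [current_periodic (N := Lc) hFp a x t]
  have hJdiv : ∀ p : Site (d + 1), ∑ b : Fin (d + 1), (J b p - J b (p - unitVec b)) = 0 := by
    intro p
    have h := smul_curvAdj_divFree Fμα (K₁ * (-(1 / 2 : ℝ))) p
    simp only [hJ]
    simpa only [mul_assoc] using h
  -- step 1: pull `s_f²` out and recognise `⟨J, Π_bm A⟩_cell`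
  have h1 : ∑ r' ∈ box (d + 1) Lc, ∑ a : Fin (d + 1), J a (toSite r') * ((sf * sf) * coProjBmW (toSite r) Lc A a (toSite r')) =
      (sf * sf) * ∑ r' ∈ box (d + 1) Lc, ∑ a : Fin (d + 1), J a (toSite r') * coProjBmW (toSite r) Lc A a (toSite r') := by
    rw [Finset.mul_sum]
    refine Finset.sum_congr rfl fun r' _ => ?_
    rw [Finset.mul_sum]
    exact Finset.sum_congr rfl fun a _ => by ring
  -- step 2: cell adjointness and `Πᵀ_bm J = J`
  have h2 : ∑ r' ∈ box (d + 1) Lc, ∑ a : Fin (d + 1), J a (toSite r') * coProjBmW (toSite r) Lc A a (toSite r') =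
      ∑ r' ∈ box (d + 1) Lc, ∑ a : Fin (d + 1), J a (toSite r') * A a (toSite r') := by
    rw [DressedKernelOnCurrent.sum_box_mul_coProjBmW (toSite r) hLc hJp hAp, coProjBmAt_eq_self_of_divFree hLc hr hJdiv]
  -- step 3: constants out, then the exchange number
  have h3 : ∑ r' ∈ box (d + 1) Lc, ∑ a : Fin (d + 1), J a (toSite r') * A a (toSite r') =
      (K₁ * (K₁ * (-1 : ℝ))) * ∑ r' ∈ box (d + 1) Lc, ∑ a : Fin (d + 1), (-(1 / 2 : ℝ) * curvAdj Fμα a (toSite r')) * R a (toSite r') := by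
    rw [Finset.mul_sum]
    refine Finset.sum_congr rfl fun r' _ => ?_
    rw [Finset.mul_sum]
    exact Finset.sum_congr rfl fun a _ => by rw [hAR]; simp only [hJ]; ring
  have h4 : ∑ r' ∈ box (d + 1) Lc, ∑ a : Fin (d + 1), (-(1 / 2 : ℝ) * curvAdj Fμα a (toSite r')) * R a (toSite r') =
      ((if μ = ν ∧ α = β then (1 : ℝ) else 0) - (if μ = β ∧ α = ν then (1 : ℝ) else 0)) * ((1 / 2 : ℝ) * (1 - ((Lc : ℝ) ^ 2)⁻¹) * (Lc : ℝ) ^ (d - 1)) := by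
    simp only [hR, hFμα, hFνβ]
    exact FaceCurrentExchangeValue.pairing_face (N := Lc) hνβ (γ' := μ) (α' := α)
  show ∑ r' ∈ box (d + 1) Lc, ∑ a : Fin (d + 1), J a (toSite r') * ((sf * sf) * coProjBmW (toSite r) Lc A a (toSite r')) =
    -K₁ ^ 2 * (sf * sf) * (((if μ = ν ∧ α = β then (1 : ℝ) else 0) - (if μ = β ∧ α = ν then (1 : ℝ) else 0)) * ((1 / 2 : ℝ) * (1 - ((Lc : ℝ) ^ 2)⁻¹) * (Lc : ℝ) ^ (d - 1)))
  rw [h1, h2, h3, h4]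
  ring

end CellValue

end Summit.QuantumFields.BalabanUV.Beta.GAN24.DressedKernelOnFaceCurrent

end
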